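import Mathlib
import Summits.Ventures.PercRepro2.PosClassOS
import Summits.Ventures.PercRepro2.PosClassMarks
import Summits.Ventures.PercRepro2.PosClassSplitSW
import Summits.Ventures.PercRepro2.TB14CutTransfer
import Summits.Ventures.PercRepro2.TB14CutInduction

/-!
# The block reduction of the pair {(TB13), (OS)}: from the graphs without a proper cut to all graphs
(blind cell PercRepro2, p5 g8, 2026-08-26; `proofs/P5-POSCLASS.md` §2′)

`Pair F z ends s u v w` is the pair {(TB13) `0 ≤ out`, (OS) `0 ≤ out + red`} of the position-class
statistics of typed Harris (`PosClass.stat`).  **`pair_step`**: at a cut vertex `x` with the root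
`s` on the `A`-side, the pair on both side profiles (for every quadruple of vertices) gives the pair
on the full profile — the eight placements of `u, v, w` are the transport theorems of
`PosClassOS` (`w` behind the cut), `PosClassMarks` (a mark / the root behind the cut),
`PosClassSplit` / `PosClassSplitSW` (two on each side) and `stat_same_side`.  **`pair_allFree_of_noProperCut`**
(THEOREM, mine-c's `tb14_allFree_of_noProperCut` pattern): if the pair holds at the all-free profile
on every finite graph WITHOUT a proper cut (a cut vertex with an edge on each side — the 2-connected
graphs, isolated vertices allowed), then it holds on every finite graph — by strong induction on the
number of edges, the side instances being the all-free instances of the sides' own graphs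
(`TB14Cut.pairCount_side_eq_subtype`).  So the pair {(TB13), (OS)} is open exactly on its
2-connected instances.  Own work; standard axioms.
-/

namespace Summit.Ventures.PercRepro2

namespace PosClass

open CovForm A3InactiveTyped CutV TB14Cut

section Symm

variable {V : Type*} {E : Type*} [Fintype E] [DecidableEq E] {R : Type*} [Field R]
  [LinearOrder R] [IsStrictOrderedRing R]

omit [LinearOrder R] [IsStrictOrderedRing R] in
/-- The class statistic is symmetric in the two marks. -/
lemma stat_comm (F : Finset E) (z : Config E) (ends : E → Sym2 V) (s u v : V)
    (k : Config E → Config E → R) : stat F z ends s u v k = stat F z ends s v u k := by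
  unfold stat
  congr 1
  funext y y'
  ring

omit [LinearOrder R] [IsStrictOrderedRing R] in
/-- The blue-only and red-only class statistics agree (the copy swap). -/
lemma stat_kBlue_eq_kRed (F : Finset E) (z : Config E) (ends : E → Sym2 V) (s u v w : V) :
    (stat F z ends s u v (kBlue ends s w) : R) = stat F z ends s u v (kRed ends s w) := by
  unfold stat
  rw [pairCount_swap]
  congr 1
  funext y y'
  unfold odd kRed kBlue
  ring

/-- **The pair** {(TB13), (OS)} at a profile. -/
def Pair (F : Finset E) (z : Config E) (ends : E → Sym2 V) (s u v w : V) : Prop :=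
  0 ≤ (stat F z ends s u v (kOut ends s w) : R) ∧
  0 ≤ (stat F z ends s u v (kOut ends s w) : R) + stat F z ends s u v (kRed ends s w)

omit [IsStrictOrderedRing R] in
/-- The pair gives the three-sign form (the blue (OS) is the red one). -/
lemma Pair.classPair {F : Finset E} {z : Config E} {ends : E → Sym2 V} {s u v w : V}
    (h : Pair (R := R) F z ends s u v w) : ClassPair (R := R) F z ends s u v w :=
  ⟨h.1, h.2, by rw [stat_kBlue_eq_kRed]; exact h.2⟩

omit [IsStrictOrderedRing R] in
/-- The three-sign form gives the pair. -/
lemma Pair.of_classPair {F : Finset E} {z : Config E} {ends : E → Sym2 V} {s u v w : V}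
    (h : ClassPair (R := R) F z ends s u v w) : Pair (R := R) F z ends s u v w :=
  ⟨h.1, h.2.1⟩

omit [IsStrictOrderedRing R] in
/-- The pair is symmetric in the two marks. -/
lemma Pair.comm {F : Finset E} {z : Config E} {ends : E → Sym2 V} {s u v w : V}
    (h : Pair (R := R) F z ends s v u w) : Pair (R := R) F z ends s u v w := by
  unfold Pair at h ⊢
  rw [stat_comm F z ends s u v, stat_comm F z ends s u v]
  exact h

end Symm

section Extend

variable {V : Type*} {E : Type*} [Fintype E] [DecidableEq E] {R : Type*} [Field R]
  [LinearOrder R] [IsStrictOrderedRing R] (S : Set E) [DecidablePred (· ∈ S)]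

omit [Fintype E] [DecidableEq E] [LinearOrder R] [IsStrictOrderedRing R] in
/-- The odd statistic transfers to the side's own graph. -/
lemma odd_extend (ends : E → Sym2 V) (u u' : Config {e // e ∈ S}) (a v : V) :
    (odd ends a v (extend S u) (extend S u') : R) = odd (sideEnds S ends) a v u u' := by
  unfold odd
  rw [iL_extend, iL_extend]

omit [Fintype E] [DecidableEq E] [LinearOrder R] [IsStrictOrderedRing R] in
/-- The class kernels transfer to the side's own graph. -/
lemma kOut_extend (ends : E → Sym2 V) (u u' : Config {e // e ∈ S}) (a v : V) :
    (kOut ends a v (extend S u) (extend S u') : R) = kOut (sideEnds S ends) a v u u' := by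
  unfold kOut
  rw [iL_extend, iL_extend]

omit [Fintype E] [DecidableEq E] [LinearOrder R] [IsStrictOrderedRing R] in
/-- The class kernels transfer to the side's own graph. -/
lemma kRed_extend (ends : E → Sym2 V) (u u' : Config {e // e ∈ S}) (a v : V) :
    (kRed ends a v (extend S u) (extend S u') : R) = kRed (sideEnds S ends) a v u u' := by
  unfold kRed
  rw [iL_extend, iL_extend]

omit [LinearOrder R] [IsStrictOrderedRing R] in
/-- **The side statistic is the all-free statistic of the side's own graph** (class «outside»). -/
theorem stat_out_side_eq_subtype (ends : E → Sym2 V) (s u v w : V) :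
    (stat (sideFree S Finset.univ) (restrict S (fun _ => false)) ends s u v (kOut ends s w) : R) =
      stat (Finset.univ : Finset {e // e ∈ S}) (fun _ => false) (sideEnds S ends) s u v
        (kOut (sideEnds S ends) s w) := by
  unfold stat
  rw [pairCount_side_eq_subtype]
  congr 1
  funext y y'
  rw [odd_extend, odd_extend, kOut_extend]

omit [LinearOrder R] [IsStrictOrderedRing R] in
/-- **The side statistic is the all-free statistic of the side's own graph** (class «red-only»). -/
theorem stat_red_side_eq_subtype (ends : E → Sym2 V) (s u v w : V) :
    (stat (sideFree S Finset.univ) (restrict S (fun _ => false)) ends s u v (kRed ends s w) : R) =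
      stat (Finset.univ : Finset {e // e ∈ S}) (fun _ => false) (sideEnds S ends) s u v
        (kRed (sideEnds S ends) s w) := by
  unfold stat
  rw [pairCount_side_eq_subtype]
  congr 1
  funext y y'
  rw [odd_extend, odd_extend, kRed_extend]

omit [IsStrictOrderedRing R] in
/-- The pair at the side profile is the pair of the side's own graph. -/
lemma pair_side_iff (ends : E → Sym2 V) (s u v w : V) :
    Pair (R := R) (sideFree S Finset.univ) (restrict S (fun _ => false)) ends s u v w ↔
      Pair (R := R) (Finset.univ : Finset {e // e ∈ S}) (fun _ => false) (sideEnds S ends) s u v w := by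
  unfold Pair
  rw [stat_out_side_eq_subtype, stat_red_side_eq_subtype]

end Extend

section Step

variable {V : Type*} {E : Type*} [Fintype E] [DecidableEq E] {R : Type*} [Field R]
  [LinearOrder R] [IsStrictOrderedRing R] {ends : E → Sym2 V} {x : V} {VA VB : Set V}
  {EA EB : Set E} [DecidablePred (· ∈ EA)] [DecidablePred (· ∈ EB)]

/-- The pair on the same side, scaled by the total count of the other side. -/
lemma pair_same_side (h : IsCut ends x VA VB EA EB) (F : Finset E) (z : Config E) {s u v w : V}
    (hs : s ∈ VA ∪ {x}) (hu : u ∈ VA ∪ {x}) (hv : v ∈ VA ∪ {x}) (hw : w ∈ VA ∪ {x})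
    (hA : Pair (R := R) (sideFree EA F) (restrict EA z) ends s u v w) :
    Pair (R := R) F z ends s u v w := by
  have hT := pairCount_nonneg' (R := R) (sideFree EB F) (restrict EB z) (fun _ _ => 1)
    (fun _ _ => zero_le_one)
  have e1 := stat_same_side (R := R) h F z hs hu hv hw (fun a b => kOut ends a b)
    (fun a b hab y y' => kOut_restrict hab y y')
  have e2 := stat_same_side (R := R) h F z hs hu hv hw (fun a b => kRed ends a b)
    (fun a b hab y y' => kRed_restrict hab y y')
  obtain ⟨h1, h2⟩ := hA
  refine ⟨?_, ?_⟩
  · rw [e1]; exact mul_nonneg h1 hT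
  · rw [e1, e2, ← add_mul]; exact mul_nonneg h2 hT

/-- **The induction step at a cut vertex** (root on the `A`-side): the pair on both side profiles,
for every quadruple, gives the pair on the full profile. -/
theorem pair_step (h : IsCut ends x VA VB EA EB) (F : Finset E) (z : Config E) {s u v w : V}
    (hs : s ∈ VA ∪ {x}) (hcov : ∀ y : V, y ∈ VA ∪ {x} ∨ y ∈ VB)
    (IHA : ∀ a b c d : V, Pair (R := R) (sideFree EA F) (restrict EA z) ends a b c d)
    (IHB : ∀ a b c d : V, Pair (R := R) (sideFree EB F) (restrict EB z) ends a b c d) :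
    Pair (R := R) F z ends s u v w := by
  rcases hcov u with hu | hu <;> rcases hcov v with hv | hv <;> rcases hcov w with hw | hw
  · -- all four on the A-side
    exact pair_same_side h F z hs hu hv hw (IHA s u v w)
  · -- w behind the cut
    exact Pair.of_classPair (classPair_of_cut h F z hs hu hv hw (IHA s u v x).classPair)
  · -- v behind the cut (a mark)
    obtain ⟨h1, h2, h3⟩ := (IHA s x u w).classPair
    exact Pair.comm (Pair.of_classPair (classPair_mark_of_cut h F z hs hv hu hw h1 h2 h3))
  · -- v, w behind the cut: the split placement `s, u | v, w`
    exact ⟨tb13_split h F z hs hu hv hw, os_split h F z hs hu hv hw⟩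
  · -- u behind the cut (a mark)
    obtain ⟨h1, h2, h3⟩ := (IHA s x v w).classPair
    exact Pair.of_classPair (classPair_mark_of_cut h F z hs hu hv hw h1 h2 h3)
  · -- u, w behind the cut: the split placement `s, v | u, w`
    exact Pair.comm ⟨tb13_split h F z hs hv hu hw, os_split h F z hs hv hu hw⟩
  · -- u, v behind the cut: the placement `s, w | u, v`
    exact Pair.of_classPair (classPair_split_sw h F z hs hu hv hw)
  · -- u, v, w behind the cut: the root alone on the A-side
    rcases hs with hs | hs
    · obtain ⟨h1, h2, h3⟩ := (IHB x u v w).classPair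
      exact Pair.of_classPair (classPair_root_of_cut h.symm F z hs (Or.inl hu) (Or.inl hv)
        (Or.inl hw) h1 h2 h3)
    · rw [Set.mem_singleton_iff] at hs
      subst hs
      exact pair_same_side h.symm F z (Or.inr rfl) (Or.inl hu) (Or.inl hv) (Or.inl hw)
        (IHB s u v w)

end Step

section Induction

variable (R : Type*) [Field R] [LinearOrder R] [IsStrictOrderedRing R]

/-- The strong induction on the number of edges. -/
theorem pair_allFree_aux
    (H : ∀ (V E : Type) [Fintype E] [DecidableEq E] (ends : E → Sym2 V),
      (¬ ∃ (c : V) (VA VB : Set V) (EA EB : Set E),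
        IsCut ends c VA VB EA EB ∧ EA.Nonempty ∧ EB.Nonempty) →
      ∀ s u v w : V, Pair (R := R) Finset.univ (fun _ => false) ends s u v w)
    (n : ℕ) :
    ∀ (V E : Type) [Fintype E] [DecidableEq E] (ends : E → Sym2 V), Fintype.card E = n →
      ∀ s u v w : V, Pair (R := R) Finset.univ (fun _ => false) ends s u v w := by
  induction n using Nat.strong_induction_on with
  | _ n ih =>
    intro V E _ _ ends hn s u v w
    by_cases hcut : ∃ (c : V) (VA VB : Set V) (EA EB : Set E),
        IsCut ends c VA VB EA EB ∧ EA.Nonempty ∧ EB.Nonempty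
    · obtain ⟨c, VA, VB, EA, EB, h, hEA, hEB⟩ := hcut
      classical
      have h' := isCut_isolated h
      have IHA : ∀ a b c' d : V,
          Pair (R := R) (sideFree EA Finset.univ) (restrict EA (fun _ => false)) ends a b c' d := by
        intro a b c' d
        rw [pair_side_iff]
        obtain ⟨e, he⟩ := hEB
        have hlt : Fintype.card {e // e ∈ EA} < n := by
          rw [← hn]
          exact Fintype.card_subtype_lt (fun heA => Set.disjoint_left.1 h.Edisj heA he)
        exact ih _ hlt V {e // e ∈ EA} (sideEnds EA ends) rfl a b c' d
      have IHB : ∀ a b c' d : V,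
          Pair (R := R) (sideFree EB Finset.univ) (restrict EB (fun _ => false)) ends a b c' d := by
        intro a b c' d
        rw [pair_side_iff]
        obtain ⟨e, he⟩ := hEA
        have hlt : Fintype.card {e // e ∈ EB} < n := by
          rw [← hn]
          exact Fintype.card_subtype_lt (fun heB => Set.disjoint_left.1 h.Edisj he heB)
        exact ih _ hlt V {e // e ∈ EB} (sideEnds EB ends) rfl a b c' d
      have hcov0 : ∀ y : V, y ∈ (VA ∪ (VA ∪ VB ∪ {c})ᶜ) ∪ {c} ∨ y ∈ VB ∪ {c} :=
        fun y => isolated_cover y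
      -- the cover, strict on the B-side
      have hcovB : ∀ y : V, y ∈ (VA ∪ (VA ∪ VB ∪ {c})ᶜ) ∪ {c} ∨ y ∈ VB := by
        intro y
        rcases hcov0 y with hy | hy
        · exact Or.inl hy
        · rcases hy with hy | hy
          · exact Or.inr hy
          · exact Or.inl (Or.inr hy)
      -- the cover, strict on the A-side
      have hcovA : ∀ y : V, y ∈ VB ∪ {c} ∨ y ∈ VA ∪ (VA ∪ VB ∪ {c})ᶜ := by
        intro y
        rcases hcov0 y with hy | hy
        · rcases hy with hy | hy
          · exact Or.inr hy
          · exact Or.inl (Or.inr hy)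
        · exact Or.inl hy
      rcases hcovB s with hs | hs
      · exact pair_step h' Finset.univ (fun _ => false) hs hcovB IHA IHB
      · exact pair_step h'.symm Finset.univ (fun _ => false) (Or.inl hs) hcovA IHB IHA
    · exact H V E ends hcut s u v w

/-- **The block reduction of the pair {(TB13), (OS)}** (THEOREM): if the pair holds at the all-free
profile on every finite graph without a proper cut (a cut vertex with an edge on each side — the
2-connected graphs, isolated vertices allowed), then it holds on every finite graph. -/
theorem pair_allFree_of_noProperCut
    (H : ∀ (V E : Type) [Fintype E] [DecidableEq E] (ends : E → Sym2 V),
      (¬ ∃ (c : V) (VA VB : Set V) (EA EB : Set E),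
        IsCut ends c VA VB EA EB ∧ EA.Nonempty ∧ EB.Nonempty) →
      ∀ s u v w : V, Pair (R := R) Finset.univ (fun _ => false) ends s u v w) :
    ∀ (V E : Type) [Fintype E] [DecidableEq E] (ends : E → Sym2 V) (s u v w : V),
      Pair (R := R) Finset.univ (fun _ => false) ends s u v w :=
  fun V E _ _ ends s u v w => pair_allFree_aux R H (Fintype.card E) V E ends rfl s u v w

end Induction

end PosClass

end Summit.Ventures.PercRepro2
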